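import Summits.BirchSwinnertonDyer.BirchSwinnertonDyer.Theorems.EisensteinDepletionAtTwoStarEisEightGlobalNewman
import HarnessLib

/-!
# Route `EisensteinDepletionAtTwo`, crux E1M `DepletedLambdaLawAtTwoMod` (stmt-BirchSwinnertonDyer-20341), line `star`:
# (★-EisEightGlobal), part 2 — the square condition and the theorem: `‖φ_β(γ_{b,d})‖₂ ≤ 8⁻¹` at EVERY cusp

Cell `bsd-rank2` (HOME run/shared/lean/pub/bsd-rank2/), lead `bsd-rank2-star-p1` GEN 3 (helper `--supports` the crux item; skeleton
`Cruxes/DepletedLambdaLawAtTwoMod/Lines/star.lean` v3.7, stub `stub_starEisEightGlobal`). Sequel of `…StarEisEightGlobalNewman.lean`: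

* §3 `isSquare_prod_pow_natAbs` — Newman's SQUARE condition for `r_t = N c_t`: `∏_{t ∣ N} t^{|N c_t|}` is a perfect square. The
  exponent of a prime `ℓ ∣ N` is `Σ_t |N c_t| v_ℓ(t) ≡ Σ_t N c_t v_ℓ(t) (mod 2)`, and with `v_ℓ = 2 − [v_ℓ = 0] − [v_ℓ ≤ 1]` on the
  divisors (all exponents `≤ 2`) and the multiplicativity of `t ↦ c_t·w(t)` for the two indicator weights,
  `Σ_t c_t v_ℓ(t) = −(2 + c_ℓ(1)) ∏_{ℓ' ≠ ℓ} L_{ℓ'}(1)`, so `Σ_t N c_t v_ℓ(t) = −(2ℓ^e + ℓ^e c_ℓ(1)) · ∏_{ℓ' ≠ ℓ} ℓ'^{e'} L_{ℓ'}(1)`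
  with every `ℓ'^{e'} L_{ℓ'}(1) ∈ {ℓ' − 1, 0}` EVEN, and `ℓ^e c_ℓ(1) = −ℓ(1+ℓ)` even in the one-prime case `N = ℓ²`.
* §4 `star_eisEightGlobal` — the registered stub, by `norm_stabEisensteinPeriod_le_eighth_of_newmanCond` (part 1) and the tree's
  `Literature.NumberTheory.ModularForms.etaQuotient_logPeriod_mem_int` (Newman/Ligozat + Rademacher (60)).

NUMERICS (lead GEN 3 kit j291618–j291630, N < 10⁴): `v₂(content of φ_β) = 3` in all 13198 (class, β) evaluations. THEOREMS ONLY; no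
`sorry`; standard axioms. PARTITION: none — r_an ≥ 2, summit axis S0; TWIN (D-0056): n/a. B1 honesty: Dedekind-sum / η-multiplier
bookkeeping; no elliptic curve appears; nothing reads an analytic rank; (★-SymbC)/(★)/E1M/BSD are NOT proved by this.

References: H. Rademacher, E. Grosswald, *Dedekind Sums* (1972) Ch. 4 A (59)–(62) [RademacherGrosswald1972]; G. Stevens, *Arithmetic
on Modular Curves* (1982) §2.4–2.5 [Stevens1982]; M. Newman, *Proc. LMS* (3) 9 (1959); G. Ligozat, Mém. SMF 43 (1975) Prop. 3.2.1.
-/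

set_option linter.dupNamespace false
set_option autoImplicit false

noncomputable section

open Literature.NumberTheory.ModularForms Literature.NumberTheory.EllipticCurves
  Literature.NumberTheory.EllipticCurves.ModularForms

namespace Summit.BirchSwinnertonDyer.BirchSwinnertonDyer.Theorems.DepletionAtTwo

variable {N : ℕ} {β : ℕ → ℕ}
/-! ## §3 The square condition: `∏_{t ∣ N} t^{|N c_t|}` is a perfect square -/

section Square

variable (N β)

/-- The local value `L_{ℓ'}(1) = Σ_{j ≤ e_{ℓ'}} c_{ℓ'}(j)` (`= 1 − β_{ℓ'}/ℓ'` at `ℓ' ∥ N`, `= 0` at `ℓ'² ∥ N`). -/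
private theorem localSum_eq (hadm : IsAdmissibleStabData N β) {ℓ : ℕ} (hℓ : ℓ ∈ N.primeFactors) :
    ∑ j ∈ Finset.range (N.factorization ℓ + 1), localStabCoeff N β ℓ j =
      if N.factorization ℓ = 1 then 1 - (β ℓ : ℚ) / ℓ else 0 := by
  have hℓ0 : (ℓ : ℚ) ≠ 0 := by exact_mod_cast (Nat.prime_of_mem_primeFactors hℓ).ne_zero
  rcases factorization_eq_one_or_two_of_admissible hadm hℓ with h1 | h2
  · have := sum_range_localStabCoeff_of_eq_one N β (R := ℚ) h1 1
    simp only [one_pow, mul_one, Algebra.algebraMap_self, RingHom.id_apply] at this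
    rw [this, if_pos h1]
  · have := sum_range_localStabCoeff_of_eq_two N β (R := ℚ) h2 1
    simp only [one_pow, mul_one, Algebra.algebraMap_self, RingHom.id_apply] at this
    rw [this, if_neg (by omega)]
    field_simp
    ring

/-- `ℓ'^{e} · L_{ℓ'}(1)` is an EVEN integer (`ℓ' − β_{ℓ'} ∈ {ℓ' − 1, 0}` at `ℓ' ∥ N`, `0` at `ℓ'² ∥ N`; `N` odd). -/
private theorem exists_even_localSum (hodd : Odd N) (hadm : IsAdmissibleStabData N β) {ℓ : ℕ}
    (hℓ : ℓ ∈ N.primeFactors) :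
    ∃ h : ℤ, Even h ∧ (ℓ : ℚ) ^ N.factorization ℓ * ∑ j ∈ Finset.range (N.factorization ℓ + 1), localStabCoeff N β ℓ j = h := by
  have hℓ0 : (ℓ : ℚ) ≠ 0 := by exact_mod_cast (Nat.prime_of_mem_primeFactors hℓ).ne_zero
  have hℓodd : Odd ℓ := hodd.of_dvd_nat (Nat.dvd_of_mem_primeFactors hℓ)
  rw [localSum_eq N β hadm hℓ]
  rcases factorization_eq_one_or_two_of_admissible hadm hℓ with h1 | h2
  · rw [if_pos h1, h1, pow_one]
    rcases hadm.2.1 ℓ hℓ h1 with hb | hb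
    · refine ⟨(ℓ : ℤ) - 1, ?_, by rw [hb]; field_simp; push_cast; ring⟩
      obtain ⟨k, hk⟩ := hℓodd
      exact ⟨k, by rw [hk]; push_cast; ring⟩
    · exact ⟨0, ⟨0, rfl⟩, by rw [hb, div_self hℓ0, sub_self, mul_zero]; simp⟩
  · exact ⟨0, ⟨0, rfl⟩, by rw [if_neg (by omega), mul_zero]; simp⟩

/-- The indicator weights `w₀ = [v_ℓ = 0]`, `w₁ = [v_ℓ ≤ 1]` and the divisor sums `Σ c_t w_i(t)`. -/
private theorem sum_stabCoeff_indicator_zero (hN : N ≠ 0) {ℓ : ℕ} (hℓ : ℓ ∈ N.primeFactors) :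
    ∑ t ∈ N.divisors, stabCoeff N β t * (if t.factorization ℓ = 0 then (1 : ℚ) else 0) =
      ∏ ℓ' ∈ N.primeFactors.erase ℓ, ∑ j ∈ Finset.range (N.factorization ℓ' + 1), localStabCoeff N β ℓ' j := by
  have hℓp : ℓ.Prime := Nat.prime_of_mem_primeFactors hℓ
  have h := sum_divisors_stabCoeff_mul N β (R := ℚ) (fun t ↦ if t.factorization ℓ = 0 then (1 : ℚ) else 0)
    (by simp) (fun m n hm hn _ ↦ by
      rw [Nat.factorization_mul hm hn, Finsupp.add_apply]
      by_cases ha : m.factorization ℓ = 0 <;> by_cases hb : n.factorization ℓ = 0 <;> simp [ha, hb]) hN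
  simp only [Algebra.algebraMap_self, RingHom.id_apply] at h
  rw [h, ← Finset.mul_prod_erase _ _ hℓ]
  -- the factor at `ℓ` is `c_ℓ(0) = 1`
  have hℓfac : ∑ j ∈ Finset.range (N.factorization ℓ + 1),
      stabCoeff N β (ℓ ^ j) * (if (ℓ ^ j).factorization ℓ = 0 then (1 : ℚ) else 0) = 1 := by
    rw [Finset.sum_eq_single 0]
    · simp [stabCoeff_one]
    · intro j _ hj
      rw [hℓp.factorization_pow, Finsupp.single_eq_same, if_neg hj, mul_zero]
    · intro h0; exact absurd (Finset.mem_range.mpr (Nat.succ_pos _)) h0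
  rw [hℓfac, one_mul]
  refine Finset.prod_congr rfl fun ℓ' hℓ' ↦ Finset.sum_congr rfl fun j _ ↦ ?_
  have hne : ℓ' ≠ ℓ := Finset.ne_of_mem_erase hℓ'
  have hℓ'p : ℓ'.Prime := Nat.prime_of_mem_primeFactors (Finset.mem_of_mem_erase hℓ')
  rw [stabCoeff_prime_pow N β (Finset.mem_of_mem_erase hℓ'), hℓ'p.factorization_pow,
    Finsupp.single_eq_of_ne (Ne.symm hne), if_pos rfl, mul_one]

/-- `Σ_t c_t·[v_ℓ(t) ≤ 1] = (1 + c_ℓ(1)) · ∏_{ℓ' ≠ ℓ} L_{ℓ'}(1)` (the weight is multiplicative on coprime arguments). -/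
private theorem sum_stabCoeff_indicator_one (hadm : IsAdmissibleStabData N β) (hN : N ≠ 0) {ℓ : ℕ}
    (hℓ : ℓ ∈ N.primeFactors) :
    ∑ t ∈ N.divisors, stabCoeff N β t * (if t.factorization ℓ ≤ 1 then (1 : ℚ) else 0) =
      (1 + localStabCoeff N β ℓ 1) *
        ∏ ℓ' ∈ N.primeFactors.erase ℓ, ∑ j ∈ Finset.range (N.factorization ℓ' + 1), localStabCoeff N β ℓ' j := by
  have hℓp : ℓ.Prime := Nat.prime_of_mem_primeFactors hℓ
  have h := sum_divisors_stabCoeff_mul N β (R := ℚ) (fun t ↦ if t.factorization ℓ ≤ 1 then (1 : ℚ) else 0)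
    (by simp) (fun m n hm hn hmn ↦ by
      rw [Nat.factorization_mul hm hn, Finsupp.add_apply]
      -- one of the two exponents vanishes (coprimality)
      have hz : m.factorization ℓ = 0 ∨ n.factorization ℓ = 0 := by
        by_contra hc
        push Not at hc
        have hpm : ℓ ∣ m := Nat.dvd_of_factorization_pos hc.1
        have hpn : ℓ ∣ n := Nat.dvd_of_factorization_pos hc.2
        exact hℓp.one_lt.ne' (Nat.eq_one_of_dvd_coprimes hmn hpm hpn)
      rcases hz with ha | hb
      · rw [ha, zero_add]; by_cases hb : n.factorization ℓ ≤ 1 <;> simp [hb]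
      · rw [hb, add_zero]; by_cases ha : m.factorization ℓ ≤ 1 <;> simp [ha]) hN
  simp only [Algebra.algebraMap_self, RingHom.id_apply] at h
  rw [h, ← Finset.mul_prod_erase _ _ hℓ]
  -- the factor at `ℓ` is `c_ℓ(0) + c_ℓ(1)`
  have hℓfac : ∑ j ∈ Finset.range (N.factorization ℓ + 1),
      stabCoeff N β (ℓ ^ j) * (if (ℓ ^ j).factorization ℓ ≤ 1 then (1 : ℚ) else 0) =
        1 + localStabCoeff N β ℓ 1 := by
    have hterm : ∀ j, stabCoeff N β (ℓ ^ j) * (if (ℓ ^ j).factorization ℓ ≤ 1 then (1 : ℚ) else 0) =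
        if j ≤ 1 then localStabCoeff N β ℓ j else 0 := by
      intro j
      rw [stabCoeff_prime_pow N β hℓ, hℓp.factorization_pow, Finsupp.single_eq_same]
      split_ifs <;> simp
    simp_rw [hterm]
    rcases factorization_eq_one_or_two_of_admissible hadm hℓ with h1 | h2
    · rw [h1]
      simp [Finset.sum_range_succ, localStabCoeff_zero]
    · rw [h2]
      simp [Finset.sum_range_succ, localStabCoeff_zero]
  rw [hℓfac]
  congr 1
  refine Finset.prod_congr rfl fun ℓ' hℓ' ↦ Finset.sum_congr rfl fun j _ ↦ ?_
  have hne : ℓ' ≠ ℓ := Finset.ne_of_mem_erase hℓ'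
  have hℓ'p : ℓ'.Prime := Nat.prime_of_mem_primeFactors (Finset.mem_of_mem_erase hℓ')
  rw [stabCoeff_prime_pow N β (Finset.mem_of_mem_erase hℓ'), hℓ'p.factorization_pow,
    Finsupp.single_eq_of_ne (Ne.symm hne), if_pos (Nat.zero_le _), mul_one]

/-- **`Σ_{t ∣ N} c_t · v_ℓ(t) = −(2 + c_ℓ(1)) · ∏_{ℓ' ≠ ℓ} L_{ℓ'}(1)`** (`v_ℓ = 2 − [v_ℓ = 0] − [v_ℓ ≤ 1]` on the divisors, all
exponents being `≤ 2`, and `Σ c_t = 0`). [cite: Stevens1982, §2.4 (PDF pp. 35–37)] -/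
private theorem sum_stabCoeff_mul_factorization (hadm : IsAdmissibleStabData N β) (hN : N ≠ 0) {ℓ : ℕ}
    (hℓ : ℓ ∈ N.primeFactors) :
    ∑ t ∈ N.divisors, stabCoeff N β t * (t.factorization ℓ : ℚ) =
      -(2 + localStabCoeff N β ℓ 1) *
        ∏ ℓ' ∈ N.primeFactors.erase ℓ, ∑ j ∈ Finset.range (N.factorization ℓ' + 1), localStabCoeff N β ℓ' j := by
  have hv : ∀ t ∈ N.divisors, stabCoeff N β t * (t.factorization ℓ : ℚ) =
      2 * stabCoeff N β t - stabCoeff N β t * (if t.factorization ℓ = 0 then (1 : ℚ) else 0) -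
        stabCoeff N β t * (if t.factorization ℓ ≤ 1 then (1 : ℚ) else 0) := by
    intro t ht
    have hle : t.factorization ℓ ≤ 2 :=
      ((Nat.factorization_le_iff_dvd (Nat.pos_of_mem_divisors ht).ne' hN).mpr (Nat.dvd_of_mem_divisors ht) ℓ).trans
        (by
          by_cases hℓN : ℓ ∈ N.primeFactors
          · exact hadm.1 ℓ hℓN
          · rw [Finsupp.notMem_support_iff.mp (by rwa [Nat.support_factorization])]; exact Nat.zero_le _)
    interval_cases h : t.factorization ℓ <;> simp <;> ring
  rw [Finset.sum_congr rfl hv, Finset.sum_sub_distrib, Finset.sum_sub_distrib, ← Finset.mul_sum,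
    sum_divisors_stabCoeff_eq_zero hN hadm, sum_stabCoeff_indicator_zero N β hN hℓ,
    sum_stabCoeff_indicator_one N β hadm hN hℓ]
  ring

/-- **The exponent of `ℓ` in `∏_t t^{N c_t}` is even**: `Σ_{t ∣ N} (N c_t)·v_ℓ(t) ∈ 2ℤ`. -/
private theorem even_sum_mul_factorization (hodd : Odd N) (hadm : IsAdmissibleStabData N β) (z : ℕ → ℤ)
    (hz : ∀ t, (z t : ℚ) = N * stabCoeff N β t) {ℓ : ℕ} (hℓ : ℓ ∈ N.primeFactors) :
    Even (∑ t ∈ N.divisors, z t * (t.factorization ℓ : ℤ)) := by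
  have hN : N ≠ 0 := fun h ↦ by simp [h] at hodd
  have hℓp : ℓ.Prime := Nat.prime_of_mem_primeFactors hℓ
  have hℓ0 : (ℓ : ℚ) ≠ 0 := by exact_mod_cast hℓp.ne_zero
  have hℓodd : Odd ℓ := hodd.of_dvd_nat (Nat.dvd_of_mem_primeFactors hℓ)
  -- `N = ℓ^e · M`
  have hNprod : (N : ℚ) = (ℓ : ℚ) ^ N.factorization ℓ * ∏ ℓ' ∈ N.primeFactors.erase ℓ, (ℓ' : ℚ) ^ N.factorization ℓ' := by
    have h0 : (N : ℚ) = ∏ ℓ' ∈ N.primeFactors, ((ℓ' : ℚ) ^ N.factorization ℓ') := by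
      conv_lhs => rw [← Nat.prod_factorization_pow_eq_self hN]
      rw [Nat.prod_factorization_eq_prod_primeFactors]
      push_cast
      rfl
    rw [h0, ← Finset.mul_prod_erase _ _ hℓ]
  -- the even integers `h_{ℓ'}`
  have hh : ∀ ℓ' ∈ N.primeFactors.erase ℓ, ∃ h : ℤ, Even h ∧
      (ℓ' : ℚ) ^ N.factorization ℓ' * ∑ j ∈ Finset.range (N.factorization ℓ' + 1), localStabCoeff N β ℓ' j = h :=
    fun ℓ' hℓ' ↦ exists_even_localSum N β hodd hadm (Finset.mem_of_mem_erase hℓ')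
  choose! h hh using hh
  -- the local integer `q = ℓ^e c_ℓ(1)`
  obtain ⟨q, hq, hqpar⟩ : ∃ q : ℤ, (ℓ : ℚ) ^ N.factorization ℓ * localStabCoeff N β ℓ 1 = q ∧
      (N.primeFactors.erase ℓ = ∅ → Even q) := by
    rcases factorization_eq_one_or_two_of_admissible hadm hℓ with h1 | h2
    · refine ⟨-(β ℓ : ℤ), ?_, fun hempty ↦ ?_⟩
      · simp only [localStabCoeff, h1, if_true, one_ne_zero, if_false, pow_one]
        field_simp; push_cast; ring
      · -- a single prime with exponent 1 contradicts admissibility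
        exfalso
        have hpf : N.primeFactors = {ℓ} := by
          ext p; constructor
          · intro hp; by_contra hne
            have : p ∈ N.primeFactors.erase ℓ := Finset.mem_erase.mpr ⟨fun h ↦ hne (by rw [h]; simp), hp⟩
            rw [hempty] at this; exact absurd this (Finset.notMem_empty _)
          · intro hp; rw [Finset.mem_singleton.mp hp]; exact hℓ
        rcases hadm.2.2 with ⟨p, hp, hp2⟩ | ⟨⟨p, hp, hpb⟩, ⟨p', hp', hp'b⟩⟩
        · rw [hpf, Finset.mem_singleton] at hp; subst hp; omega
        · rw [hpf, Finset.mem_singleton] at hp hp'; subst hp; subst hp'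
          rw [hpb] at hp'b; exact hℓp.one_lt.ne' hp'b
    · refine ⟨-((ℓ : ℤ) * (1 + ℓ)), ?_, fun _ ↦ ?_⟩
      · simp only [localStabCoeff, h2, show (2 : ℕ) ≠ 1 by decide, if_false, if_true, one_ne_zero]
        field_simp; push_cast; ring
      · obtain ⟨k, hk⟩ := hℓodd
        exact ⟨-((ℓ : ℤ) * (k + 1)), by rw [show (ℓ : ℤ) = 2 * k + 1 by exact_mod_cast hk]; ring⟩
  -- `S_ℓ = −(2ℓ^e + q) · ∏ h`
  have hS : ((∑ t ∈ N.divisors, z t * (t.factorization ℓ : ℤ) : ℤ) : ℚ) =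
      ((-(2 * (ℓ : ℤ) ^ N.factorization ℓ + q) * ∏ ℓ' ∈ N.primeFactors.erase ℓ, h ℓ' : ℤ) : ℚ) := by
    push_cast
    have e1 : ∑ t ∈ N.divisors, (z t : ℚ) * (t.factorization ℓ : ℚ) =
        (N : ℚ) * ∑ t ∈ N.divisors, stabCoeff N β t * (t.factorization ℓ : ℚ) := by
      rw [Finset.mul_sum]; exact Finset.sum_congr rfl fun t _ ↦ by rw [hz t]; ring
    rw [e1, sum_stabCoeff_mul_factorization N β hadm hN hℓ, hNprod, ← hq]
    rw [show ∏ ℓ' ∈ N.primeFactors.erase ℓ, (h ℓ' : ℚ) =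
        ∏ ℓ' ∈ N.primeFactors.erase ℓ, ((ℓ' : ℚ) ^ N.factorization ℓ' *
          ∑ j ∈ Finset.range (N.factorization ℓ' + 1), localStabCoeff N β ℓ' j) from
      Finset.prod_congr rfl fun ℓ' hℓ' ↦ ((hh ℓ' hℓ').2).symm, Finset.prod_mul_distrib]
    ring
  have hS' : ∑ t ∈ N.divisors, z t * (t.factorization ℓ : ℤ) =
      (-(2 * (ℓ : ℤ) ^ N.factorization ℓ + q)) * ∏ ℓ' ∈ N.primeFactors.erase ℓ, h ℓ' := by exact_mod_cast hS
  rw [hS']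
  by_cases hempty : N.primeFactors.erase ℓ = ∅
  · rw [hempty, Finset.prod_empty, mul_one]
    exact ((even_two.mul_right _).add (hqpar hempty)).neg
  · obtain ⟨ℓ₁, hℓ₁⟩ := Finset.nonempty_iff_ne_empty.mpr hempty
    have h2 : (2 : ℤ) ∣ ∏ ℓ' ∈ N.primeFactors.erase ℓ, h ℓ' :=
      (even_iff_two_dvd.mp (hh ℓ₁ hℓ₁).1).trans (Finset.dvd_prod_of_mem h hℓ₁)
    exact (even_iff_two_dvd.mpr h2).mul_left _

/-- A natural number is a square once all exponents of its factorisation are even. [folklore] -/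
private theorem isSquare_of_even_factorization' {n : ℕ} (hn : n ≠ 0) (h : ∀ p, Even (n.factorization p)) :
    IsSquare n := by
  refine ⟨n.factorization.prod fun p k ↦ p ^ (k / 2), ?_⟩
  rw [← Finsupp.prod_mul]
  conv_lhs => rw [← Nat.prod_factorization_pow_eq_self hn]
  apply Finsupp.prod_congr
  intro p _
  rw [← pow_add]
  congr 1
  obtain ⟨t, ht⟩ := h p
  omega

/-- **The square condition**: `∏_{t ∣ N} t^{|N c_t|}` is a perfect square. [cite: Stevens1982, §2.4 (PDF pp. 35–37)] -/
theorem isSquare_prod_pow_natAbs (hodd : Odd N) (hadm : IsAdmissibleStabData N β) (z : ℕ → ℤ)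
    (hz : ∀ t, (z t : ℚ) = N * stabCoeff N β t) :
    IsSquare (∏ t ∈ N.divisors, t ^ (z t).natAbs) := by
  have hN : N ≠ 0 := fun h ↦ by simp [h] at hodd
  have hne : ∀ t ∈ N.divisors, t ^ (z t).natAbs ≠ 0 := fun t ht ↦ pow_ne_zero _ (Nat.pos_of_mem_divisors ht).ne'
  have hA0 : ∏ t ∈ N.divisors, t ^ (z t).natAbs ≠ 0 := Finset.prod_ne_zero_iff.mpr hne
  apply isSquare_of_even_factorization' hA0
  intro p
  rw [Nat.factorization_prod hne, Finset.sum_apply']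
  simp only [Nat.factorization_pow, Finsupp.smul_apply, smul_eq_mul]
  by_cases hp : p ∈ N.primeFactors
  · -- compare with the integer sum `Σ z_t v_p(t)` (same parity as `Σ |z_t| v_p(t)`)
    have hev := even_sum_mul_factorization N β hodd hadm z hz hp
    have hcast : ((∑ t ∈ N.divisors, (z t).natAbs * t.factorization p : ℕ) : ℤ) =
        ∑ t ∈ N.divisors, |z t| * (t.factorization p : ℤ) := by
      push_cast; rfl
    have hdiff : (2 : ℤ) ∣ (∑ t ∈ N.divisors, |z t| * (t.factorization p : ℤ)) -
        ∑ t ∈ N.divisors, z t * (t.factorization p : ℤ) := by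
      rw [← Finset.sum_sub_distrib]
      refine Finset.dvd_sum fun t _ ↦ ?_
      rw [← sub_mul]
      refine Dvd.dvd.mul_right ?_ _
      rcases abs_choice (z t) with h | h
      · rw [h, sub_self]; exact dvd_zero 2
      · rw [h]; exact ⟨-(z t), by ring⟩
    rw [← Int.even_coe_nat, hcast]
    obtain ⟨c, hc⟩ := hdiff
    obtain ⟨k, hk⟩ := hev
    exact ⟨k + c, by linarith⟩
  · -- `p ∤ N`: every exponent vanishes
    have h0 : ∀ t ∈ N.divisors, (z t).natAbs * t.factorization p = 0 := by
      intro t ht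
      have : t.factorization p ≤ N.factorization p :=
        (Nat.factorization_le_iff_dvd (Nat.pos_of_mem_divisors ht).ne' hN).mpr (Nat.dvd_of_mem_divisors ht) p
      have hNp : N.factorization p = 0 := Finsupp.notMem_support_iff.mp (by rwa [Nat.support_factorization])
      rw [hNp, Nat.le_zero] at this
      rw [this, mul_zero]
    rw [Finset.sum_congr rfl h0, Finset.sum_const_zero]
    exact ⟨0, rfl⟩

end Square

/-! ## §4 (★-EisEightGlobal) -/

/-- **(★-EisEightGlobal)** — the registered stub `stub_starEisEightGlobal` of line `star` (skeleton v3.7), BY NAME after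
`unfold StarEisEightGlobal eisAt`: for odd `N`, admissible `β`, and every cusp `b/d` (`d > 0`, `gcd(d, bN) = 1`), the period of the
stabilised Eisenstein series along the Bézout matrix `(gcdA d (bN), b; −N·gcdB d (bN), d)` satisfies `‖φ_β‖₂ ≤ 8⁻¹`.
[cite: RademacherGrosswald1972, Ch. 4 A, eq. (60)] [cite: Stevens1982, §2.4–2.5 (PDF pp. 35–38)] -/
theorem star_eisEightGlobal :
    ∀ (N : ℕ), Odd N → ∀ (β : ℕ → ℕ), IsAdmissibleStabData N β →
      ∀ b d : ℤ, 0 < d → Int.gcd d (b * N) = 1 →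
        ‖((stabEisensteinPeriod N β (Int.gcdA d (b * N)) b (-(N : ℤ) * Int.gcdB d (b * N)) d : ℚ) : ℚ_[2])‖ ≤ 8⁻¹ := by
  intro N hodd β hadm b d hd hcop
  obtain ⟨r, hr, hsum, h1, h2, hz⟩ := exists_exponentVector (N := N) (β := β) hodd hadm
  choose z hz1 hz2 using hz
  have hsq : IsSquare (∏ t ∈ N.divisors, t ^ (r t).natAbs) := by
    have e : ∏ t ∈ N.divisors, t ^ (r t).natAbs = (∏ t ∈ N.divisors, t ^ (z t).natAbs) ^ 3 := by
      rw [← Finset.prod_pow]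
      refine Finset.prod_congr rfl fun t _ ↦ ?_
      rw [hz1 t, Int.natAbs_mul, show (3 : ℤ).natAbs = 3 from rfl, mul_comm, pow_mul]
    rw [e]
    exact (isSquare_prod_pow_natAbs N β hodd hadm z hz2).pow 3
  exact norm_stabEisensteinPeriod_le_eighth_of_newmanCond hodd hadm r hr ⟨hsum, h1, h2, hsq⟩ b d hd hcop

end Summit.BirchSwinnertonDyer.BirchSwinnertonDyer.Theorems.DepletionAtTwo

end
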